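import Summits.HodgeConjecture.HodgeConjecture.Theses.NodalThetaWeil
import Literature.AlgebraicGeometry.HodgeTheory.WeilClassesHodgeType
import Literature.AlgebraicGeometry.HodgeTheory.TopDegreeClasses
import Literature.AlgebraicGeometry.Motives.Cycles

/-!
# Line `chow-weil` of the crux `NodalThetaSupport` (stmt-HodgeConjecture-7744), route `NodalThetaWeil`
# — "the Weil-isotypic zero-cycles of a Weil sixfold vanish" (strengthen lens: coniveau ⇐ Chow)

Crux `X1 = NodalThetaSupport`: on an abelian SIXFOLD of Weil type `(A, φ ≫ φ = -d·𝟙)` every rational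
`(3,3)`-class of the Weil plane `W = E₊ ⊕ E₋ = weilClassesOf A φ 3 d ⊆ H⁶(A(ℂ); ℂ)` lies in
`N¹H⁶ = supportedClasses A.X 6 1`.

This line moves the crux from Hodge theory to ZERO-CYCLES. The Künneth projector of `H⁶(A)` onto
`W` is a LEFSCHETZ class on `A × A` (it is invariant under the unitary group `U(V, H)` of the
`K`-hermitian form: `⋀⁶V₊ ⊗ ⋀⁶V₋' = det ⊗ det⁻¹`), hence (Milne 1999) a polynomial in divisor
classes; explicitly `Γ_W = Q_d(λ_1, λ_φ)` with `λ_ψ = (ψ × 1)^*(m^*θ - pr₁^*θ - pr₂^*θ)` the Mumford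
classes of a `K`-hermitian ample `θ` and `Q_d(X, Y) = Σ_{j=0}^{3} (-1)^j C(6,2j) d^{3-j} X^{6-2j} Y^{2j}`
(`= d³·2⁵·Re((X + Y/(i√d))⁶)`). It is an honest algebraic cycle on `A × A`, and by the theorem of
Bloch–Srinivas (Voisin, Hodge Theory II, Thm. 10.19 / Cor. 10.20) it is rationally equivalent to a
cycle supported on `D × A`, `D ⊊ A` closed, as soon as it acts as ZERO on all points:
`Γ_{W*}[b] = 0 ∈ CH₀(A)_ℚ` for every `b ∈ A(ℂ)`; and then its cohomology class
`c·(e₊ ⊗ e₋' + e₋ ⊗ e₊')`, `c ≠ 0`, dies on `(A ∖ D) × A`, i.e. `W` is supported on `D` (Künneth).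
By Bloch's formula for products of `g` algebraically trivial divisors on an abelian `g`-fold
(`D_{a_1} ⋯ D_{a_6} = χ(θ) · ([a_1] - [0]) ∗ ⋯ ∗ ([a_6] - [0])`, Bloch 1976; Beauville's Fourier
transform, 1983/86) the zero-cycle `Γ_{W*}[b] = Q_d(t_b^*θ - θ, t_{φb}^*θ - θ)` is, up to the
non-zero constant `χ(θ)`, the PONTRYAGIN sextic `Q_d([b] - [0], [φb] - [0])_∗` — a θ-FREE explicit
`ℤ`-combination of the `49` points `(s·𝟙 + t·φ)(b)`, `0 ≤ s, t ≤ 6`: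

  `𝔷_d(b) := Σ_{s,t} c(d,s,t) · [(s·𝟙 + t·φ)(b)] ∈ CH₀(A)`,
  `c(d,s,t) = (-1)^{s+t} Σ_{j=0}^{3} (-1)^j C(6,2j) C(6-2j,s) C(2j,t) d^{3-j}`

(`𝔷_d(b)` is `32·6!` times the `W`-isotypic component, for the `ℤ[φ]_*`-action, of the deepest
Beauville component `[b]_{(6)} = ([b]-[0])^{∗6}/6!` of the point `b`). So the line is:

  STUB P1 (HEART, open; lens `strengthen`): `WeilIsotypicPointsVanish` — on every abelian sixfold
  of BALANCED Weil type (`dim(V₊ ∩ H^{1,0}) = 3`) and for every `b ∈ A(ℂ)`, `𝔷_d(b)` is TORSION in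
  `CH₀(A)` (`= 0` in `CH₀(A) ⊗ ℚ`). Equivalently: the Chow group of zero-cycles of the Chow–Weil
  motive `𝔴(A) = det_K h¹(A) ⊕ conj ⊂ h⁶(A)` (Moonen 2016 / O'Sullivan 2011) vanishes.
  Status: (i) NECESSARY for HC: HC(W) ⇒ `𝔴(A) ≅_hom 𝟙(-3)²` ⇒ (Kimura–O'Sullivan finite
  dimensionality of abelian motives + symmetrically distinguished lifts) `≅_rat`, whence
  `CH⁶(𝔴(A)) = CH³(pt)² = 0`; (ii) PREDICTED unconditionally by the generalised Bloch conjecture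
  (Voisin II, Conj. 11.22: `[Γ_W]^*` kills `H^{6,0}`); (iii) a THEOREM for Weil FOURFOLDS (the
  quartic analogue, from Markman 2025 + (i)), for hyperbolic sixfolds (Markman Thm. 1.5.1 + (i)), at
  CM points (O'Sullivan) and at torsion points (Roitman); (iv) FALSE for signature `(6,0)` (Mumford:
  there `Γ_W` sees `H^{6,0}`), so balancedness is load-bearing.

  STUB P2 (Bloch–Srinivas bridge, provable from print, L): `WeilIsotypicPointsVanish A φ d` ⇒
  `weilClassesOf A φ 3 d ≤ supportedClasses A.X 6 1` (Bloch's formula identifies `𝔷_d(b)` with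
  `χ(θ)⁻¹·Γ_{W*}[b]`; Bloch–Srinivas Cor. 10.20 with `X₁' = ∅`; cycle class + Künneth on
  `(A ∖ D) × A`; `e₊', e₋'` independent).

and the kernel-checked composition `NodalThetaSupport_of : STUB P1 → STUB P2 → NodalThetaSupport`
(`c = 0` trivial; else balanced type by Deligne–Milne 4.4 "only if", `finrank_eq_of_mem_weilClassesOf`,
PROVED in the tree; P1 gives the identities, P2 puts `W ∋ c` in `N¹H⁶`).

Why no costume / no shred. P1 is STRONGER than X1 (Chow ⇒ homological, via P2) and of a different
nature (an identity among `49` explicit points in `CH₀`, no Hodge class, no divisor to be found); P2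
is strictly weaker than X1 (it needs P1) and is a theorem of the Bloch–Srinivas type. Neither stub
mentions supports of the Weil class on a chosen subvariety; the difficulty is named (P1), not hidden.
Why it dodges the stuck point of line `birth`: `birth` must CONSTRUCT, for every `A`, a nodal member
of `|kΘ|` with `≥ 3k` nodes in `|3kΘ|`-special position (defect `h¹(I_Σ(3kΘ)) > 0`, Thomas 2005 §5 /
Schoen 1985 / Cynk 2001) and a `W`-visible vanishing-cycle relation; here nothing is constructed —
the supporting divisor `D` is OUTPUT of Bloch–Srinivas, and the input is a universal identity in
`CH₀(A)_ℚ` open to the zero-cycle toolbox (Bloch's `I^{∗7} = 0`, Beauville–Fourier, symmetrically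
distinguished cycles, Roitman/Mumford rational-curve techniques on `Sym^N A`, isogeny covariance).

Disproof used: none on file for this crux (no `Cruxes/NodalThetaSupport/Disproof.lean`, 2026-08-17);
negatives index of the summit: 3 entries, none in this sector.

## Contents

* `weilSexticCoeff d s t = c(d,s,t)`; `orbitPoint A φ b s t = (s·𝟙 + t·φ)(b)`; `pointClass P = [P]`;
  `weilIsotypicCycle A φ d b = 𝔷_d(b)`; `WeilIsotypicPointsVanish A φ d`.
* `stub_weilIsotypicPoints_vanish` (P1), `stub_blochSrinivas_weilPlane_supported` (P2) — `sorry`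
  ONLY here.
* `NodalThetaSupport_of` — P1 → P2 → the crux BY NAME, no `sorry`; `NodalThetaSupport_of_stubs`.
* Sanity: `weilSexticCoeff_six_zero`, `weilSexticCoeff_zero_six` (the two extreme coefficients are
  `d³` and `-1`: the cycle is not the zero combination) and `sum_weilSexticCoeff_eq_zero` (degree `0`:
  the instance `b = 0`, where all `49` orbit points coincide, holds).
-/

noncomputable section

namespace Summit.HodgeConjecture.HodgeConjecture.Cruxes.NodalThetaSupport.ChowWeil

open CategoryTheory AlgebraicGeometry
open Literature.AlgebraicGeometry.Motives Literature.AlgebraicGeometry.HodgeTheory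
  Literature.AlgebraicTopology.SingularHomology
open Summit.HodgeConjecture.HodgeConjecture.Theses.NodalThetaWeil (NodalThetaSupport)

/-! ### The Weil-isotypic zero-cycle of a point -/

/-- The coefficient `c(d,s,t) = (-1)^{s+t} Σ_{j=0}^{3} (-1)^j C(6,2j) C(6-2j,s) C(2j,t) d^{3-j}` of the
point `(s·𝟙 + t·φ)(b)` in the Pontryagin sextic
`Q_d([b]-[0], [φb]-[0])_∗ = Σ_j (-1)^j C(6,2j) d^{3-j} ([b]-[0])^{∗(6-2j)} ∗ ([φb]-[0])^{∗2j}`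
(expand `([b]-[0])^{∗p} = Σ_s (-1)^{p-s} C(p,s) [sb]`, `[x] ∗ [y] = [x+y]`).
[cite: Bloch1976, Thm. 0.1 and §1] [cite: Beauville1986, Prop. 3 and §2] -/
def weilSexticCoeff (d s t : ℕ) : ℤ :=
  (-1 : ℤ) ^ (s + t) *
    ∑ j ∈ Finset.range 4,
      (-1 : ℤ) ^ j * (Nat.choose 6 (2 * j) : ℤ) * (Nat.choose (6 - 2 * j) s : ℤ) *
        (Nat.choose (2 * j) t : ℤ) * (d : ℤ) ^ (3 - j)

/-- The point `(s·𝟙_A + t·φ)(b) ∈ A(ℂ)` of the `ℤ[φ]`-orbit of `b` (image of the complex point `b`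
under the endomorphism `s·𝟙 + t·φ`, formed in the additive group `A ⟶ A`). [folklore] -/
def orbitPoint (A : AbelianVariety ℂ) (φ : A ⟶ A) (b : ComplexPoints A.X) (s t : ℕ) :
    ComplexPoints A.X :=
  AlgPoints.map (s • 𝟙 A + t • φ).hom.hom.hom b

/-- The class `[P] ∈ CH₀(X)` of a complex point (a closed point, `height P.pt = 0`).
[cite: Fulton1998, §1.3] -/
def pointClass {X : SchemeOver ℂ} (P : ComplexPoints X) : ChowGroup X.left 0 :=
  ChowGroup.ofPoint P.pt (height_pt_eq_zero P)

/-- **The Weil-isotypic zero-cycle `𝔷_d(b) = Σ_{s,t ≤ 6} c(d,s,t)·[(s·𝟙 + t·φ)(b)] ∈ CH₀(A)`** of a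
point `b` of `(A, φ ≫ φ = -d·𝟙)`: `32·6!` times the `(6,0) ⊕ (0,6)` `ℤ[φ]_*`-isotypic component of
`([b]-[0])^{∗6}/6! = [b]_{(6)}` (Beauville's deepest component), i.e. up to `χ(θ) ≠ 0` the action
`Γ_{W*}[b]` on `[b]` of the divisor-polynomial lift `Γ_W = Q_d(λ_1, λ_φ)` of the Künneth projector
onto the Weil plane. [cite: Bloch1976, Thm. 0.1] [cite: Beauville1986, §2 and Prop. 3]
[cite: Milne1999LefschetzClasses, Thm. 3.x (Lefschetz classes are spanned by divisor products)] -/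
def weilIsotypicCycle (A : AbelianVariety ℂ) (φ : A ⟶ A) (d : ℕ) (b : ComplexPoints A.X) :
    ChowGroup A.X.left 0 :=
  ∑ s ∈ Finset.range 7, ∑ t ∈ Finset.range 7,
    weilSexticCoeff d s t • pointClass (orbitPoint A φ b s t)

/-- **`WeilIsotypicPointsVanish A φ d`**: for every complex point `b` of `A` the Weil-isotypic
zero-cycle `𝔷_d(b)` is torsion in `CH₀(A)` (vanishes in `CH₀(A) ⊗ ℚ`). Equivalently (polarisation of
the symmetric `6`-fold Pontryagin product and `ℤ[φ]`-separation): the Chow group of zero-cycles of the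
Chow–Weil motive `𝔴(A) ⊂ h⁶(A)` is zero. [cite: Moonen2016, Thm. 1 (decomposition of `h(A)` under
`End(A)`)] [cite: OSullivan2011, Thm. (symmetrically distinguished cycles)] -/
def WeilIsotypicPointsVanish (A : AbelianVariety ℂ) (φ : A ⟶ A) (d : ℕ) : Prop :=
  ∀ b : ComplexPoints A.X, ∃ N : ℕ, 0 < N ∧ N • weilIsotypicCycle A φ d b = 0

/-! ### The two registered stubs -/

/-- STUB P1 (THE HEART; open — lens `strengthen`: coniveau ⇐ Chow) — **the Weil-isotypic zero-cycles
of a balanced Weil sixfold vanish.** For `d ≥ 1` and `(A, φ ≫ φ = -d·𝟙)` of dimension `6` with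
`dim (V₊ ∩ H^{1,0}) = 3` (`V₊ = ker(φ^* - i√d) ⊆ H¹`), every point `b ∈ A(ℂ)` satisfies
`N·𝔷_d(b) = 0` in `CH₀(A)` for some `N ≥ 1`. Necessary for HC (HC(W) + Kimura–O'Sullivan ⇒
`CH⁶(𝔴(A)) = 0`), predicted by the generalised Bloch conjecture (`[Γ_W]^*H^{6,0} = 0`), a theorem in
dimension `4` (quartic analogue, Markman 2025 + finite-dimensionality), on hyperbolic sixfolds, at CM
points and at torsion points. Why it might fail: it is false for unbalanced signature `(6,0)`
(Mumford–Roitman: `Γ_W` then detects `H^{6,0}`), so the balancedness hypothesis carries everything; at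
`(3,3)` a failure is a point `b` with `e_W[b]_{(6)} ≠ 0`, which by Bloch–Srinivas (P2 direction is a
theorem only one way) is NOT yet a contradiction with HC — P1 is Chow-level, strictly above X1.
[cite: VoisinHodgeII2003, Conj. 11.22] [cite: Kimura2005FiniteDim, Thm. 4.2 and Cor. 7.3]
[cite: OSullivan2011, Thm. 6.x] [cite: Moonen2016, Thm. 1] [cite: Markman2025SecantWeil, Thm. 1.5.1]
[cite: Bloch1976, Thm. 0.1] -/
theorem stub_weilIsotypicPoints_vanish :
    ∀ (d : ℕ), 0 < d → ∀ (A : AbelianVariety ℂ) (φ : A ⟶ A), A.dim = 2 * 3 →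
      ∀ hsp : IsSmoothProjective (2 * 3) A.X, φ ≫ φ = -(d • 𝟙 A) →
      Module.finrank ℂ ↥(Module.End.eigenspace (complexBetti.map φ.hom.hom.hom 1).hom
            (Complex.I * (Real.sqrt d : ℂ)) ⊓ hodgeOneZero hsp) = 3 →
      WeilIsotypicPointsVanish A φ d := by
  sorry

/-- STUB P2 (the Bloch–Srinivas bridge; provable from print, L) — **if the Weil-isotypic zero-cycles
of `(A, φ, d)` vanish, the Weil plane has coniveau `≥ 1`.** Proof sketch: for a `K`-hermitian ample
symmetric `θ` (e.g. `d·L + φ^*L`), the cycle `Γ := Q_d(λ_1, λ_φ) ∈ CH⁶(A × A)`,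
`λ_ψ = (ψ × 1)^*(m^*θ - pr₁^*θ - pr₂^*θ)`, has (a) cohomology class `c·(e₊ ⊗ e₋' + e₋ ⊗ e₊')`, `c ≠ 0`
(`cl(m^*θ - θ₁ - θ₂) ∈ V₊ ⊗ V₋' ⊕ V₋ ⊗ V₊'` since `θ` is `K`-hermitian; sixth powers), and (b) action
on points `Γ_*[b] = Q_d(t_b^*θ - θ, t_{φb}^*θ - θ) = χ(θ)·𝔷_d(b)` (Bloch's formula), zero in `CH₀(A)_ℚ`
by hypothesis; Bloch–Srinivas (Voisin II Cor. 10.20 with `X₁' = ∅`) gives `mΓ = Z''` supported on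
`D × A`, `D ⊊ A` closed; so `cl(Γ)` dies in `H¹²((A ∖ D) × A) = ⊕ Hᵖ(A ∖ D) ⊗ H^q(A)` and, `e₊', e₋'`
being independent, `e₊|_{A∖D} = e₋|_{A∖D} = 0`: `W ≤ classesSupportedOn D ≤ N¹H⁶`. Why it might fail:
only through the typing (it is a theorem); `χ(θ) ≠ 0` needs `θ` ample, available since `A` is
projective with `φ` finite. [cite: VoisinHodgeII2003, Thm. 10.19 and Cor. 10.20]
[cite: BlochSrinivas1983, Prop. 1] [cite: Bloch1976, Thm. 0.1] [cite: Beauville1986, Prop. 3]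
[cite: Milne1999LefschetzClasses, Thm. 3.x] [cite: vanGeemen1994HodgeAV, 4.9 and Lemma 5.2] -/
theorem stub_blochSrinivas_weilPlane_supported :
    ∀ (d : ℕ), 0 < d → ∀ (A : AbelianVariety ℂ) (φ : A ⟶ A), A.dim = 2 * 3 →
      IsSmoothProjective (2 * 3) A.X → φ ≫ φ = -(d • 𝟙 A) →
      WeilIsotypicPointsVanish A φ d →
        weilClassesOf A φ 3 d ≤ supportedClasses A.X (2 * 3) 1 := by
  sorry

/-! ### The composition: STUB P1 → STUB P2 → the crux, by name -/

/-- **THE LINE'S COMPOSITION** (kernel-checked, no `sorry`): the vanishing of Weil-isotypic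
zero-cycles on balanced Weil sixfolds (P1) and the Bloch–Srinivas bridge (P2) give
`NodalThetaSupport`: for a rational `(3,3)` Weil class `c ≠ 0`, `(A, φ)` is balanced (Deligne–Milne
Prop. 4.4 "only if", `finrank_eq_of_mem_weilClassesOf`), P1 gives the identities, P2 puts the Weil
plane, hence `c`, in `N¹H⁶`. [cite: Deligne1982HodgeCycles, Prop. 4.4] [cite: VoisinHodgeII2003, Cor. 10.20] -/
theorem NodalThetaSupport_of :
    (∀ (d : ℕ), 0 < d → ∀ (A : AbelianVariety ℂ) (φ : A ⟶ A), A.dim = 2 * 3 →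
      ∀ hsp : IsSmoothProjective (2 * 3) A.X, φ ≫ φ = -(d • 𝟙 A) →
      Module.finrank ℂ ↥(Module.End.eigenspace (complexBetti.map φ.hom.hom.hom 1).hom
            (Complex.I * (Real.sqrt d : ℂ)) ⊓ hodgeOneZero hsp) = 3 →
      WeilIsotypicPointsVanish A φ d) →
    (∀ (d : ℕ), 0 < d → ∀ (A : AbelianVariety ℂ) (φ : A ⟶ A), A.dim = 2 * 3 →
      IsSmoothProjective (2 * 3) A.X → φ ≫ φ = -(d • 𝟙 A) →
      WeilIsotypicPointsVanish A φ d →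
        weilClassesOf A φ 3 d ≤ supportedClasses A.X (2 * 3) 1) →
    Summit.HodgeConjecture.HodgeConjecture.Theses.NodalThetaWeil.NodalThetaSupport := by
  intro hP1 hP2 d hd A φ hdim hsp hφ c _hr hh hw
  -- `c` lies in the Weil plane `E₊ ⊔ E₋`
  have hcW : c ∈ weilClassesOf A φ 3 d := mem_weilClassesOf_iff.mpr hw
  by_cases hc : c = 0
  · rw [hc]
    exact Submodule.zero_mem _
  -- a non-zero `(3,3)` Weil class forces balanced Weil type (Deligne–Milne 4.4, only if)
  have hbal := finrank_eq_of_mem_weilClassesOf (m := 3) (by norm_num) hdim hd hφ hcW hc hh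
  exact hP2 d hd A φ hdim hsp hφ (hP1 d hd A φ hdim hsp hφ hbal) hcW

/-- **The crux, closed modulo exactly the two registered stubs.** -/
theorem NodalThetaSupport_of_stubs :
    Summit.HodgeConjecture.HodgeConjecture.Theses.NodalThetaWeil.NodalThetaSupport :=
  NodalThetaSupport_of stub_weilIsotypicPoints_vanish stub_blochSrinivas_weilPlane_supported

/-! ### Sanity: the zero-cycle is a non-trivial combination of the orbit points -/

/-- The coefficient of `[6b]` is `d³`. [folklore] -/
theorem weilSexticCoeff_six_zero (d : ℕ) : weilSexticCoeff d 6 0 = (d : ℤ) ^ 3 := by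
  simp [weilSexticCoeff, Finset.sum_range_succ]

/-- The coefficient of `[6φb]` is `-1`. [folklore] -/
theorem weilSexticCoeff_zero_six (d : ℕ) : weilSexticCoeff d 0 6 = -1 := by
  simp [weilSexticCoeff, Finset.sum_range_succ]

/-- At the origin (`b = 0`, all orbit points coincide) the statement is the degree-zero identity
`Σ_{s,t} c(d,s,t) = 0`; here is that identity for the coefficient table, by computation. [folklore] -/
theorem sum_weilSexticCoeff_eq_zero (d : ℕ) :
    ∑ s ∈ Finset.range 7, ∑ t ∈ Finset.range 7, weilSexticCoeff d s t = 0 := by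
  simp [weilSexticCoeff, Finset.sum_range_succ, Nat.choose]
  all_goals ring

end Summit.HodgeConjecture.HodgeConjecture.Cruxes.NodalThetaSupport.ChowWeil

end
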